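import Literature.MathematicalPhysics.QuantumFieldTheory.BalabanImbrieJaffe1984to88.BIJ88WalkKernelDecay307

/-!
# `BalabanImbrieJaffe1984to88.BIJ88WalkKeptDecay307` — T. Bałaban, J. Imbrie, A. Jaffe, *Effective action and cluster properties of the
abelian Higgs model*, Commun. Math. Phys. **114** (1988) 257–315 [BalabanImbrieJaffe1988]: p. 307 [PDF 51] (Sect. 5.13) — **HALF THE DECAY
PAYS THE SUM OVER WALKS, THE OTHER HALF IS KEPT**: *"If the walk ω(α) wanders through more than a few cubes, we begin to pick up factors
e^{−cr(e_k)}. These control the sum over walks and partitions, and the factorials, as in [9]."* ([9] = Glimm–Jaffe–Spencer, Erice 1973: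
the combinatorial estimate of cluster expansions — split each decay factor, sum one half uniformly, keep the other half as the small factor
per far cube).

`BIJ88WalkKernelDecay307.abs_C_mul_wker_apply_le` bounds the walk kernel `C𝔫(c)` of p13's `wker` by `a(aZm)^{|c|}·W b c` for ANY supersolution
`W` of the walk recursion `Σ_{b′∈c} E b b′ · W b′ (c∖b′) ≤ W b c`.  THIS FILE manufactures supersolutions that KEEP decay: split every gauge as
`E b b′ ≤ F b b′ · G b b′` with `F ≥ 0` SUMMABLE (`Σ_{b′∈c} F b b′ ≤ K`) and `G` KEPT, and let `Q ≥ 0` be any KEPT FUNCTIONAL, super-multiplicative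
along walks — `G b b′ · Q b′ (c∖b′) ≤ Q b c` for `b′ ∈ c`, `Eout b ≤ Q b ∅`; then **`W b c = K^{|c|} · Q b c` is a supersolution**
(`supersolution_kept`), hence **`|(C𝔫(c))(x′,q)| ≤ a (aZmK)^{|c|} · Q b c`** (`abs_C_mul_wker_apply_le_kept`).  The kept functional
*"distance to a prescribed (the farthest) boundary of `c`"* — `Q b c = G b b″` if `b″ ∈ c`, else the exit weight `Q₀ b` — qualifies as soon as `G ≥ 0` is
super-multiplicative along triangles (`G b b′ · G b′ b″ ≤ G b b″`, i.e. `G = e^{−κ d}` for a pseudo-metric `d` on boundaries) and the exit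
gauge is compatible (`G b b′ · Q₀ b′ ≤ Q₀ b`, `Eout ≤ Q₀ ≤ 1`): **every walk out of `b` through `c ∋ b″` pays `K` per boundary and the kept
decay `G b b″` to the farthest prescribed boundary** (`kept_farthest`, `abs_C_mul_wker_apply_le_farthest`) — the factor *"e^{−cr(e_k)}"* per
far cube wandered through, in the form the located (5.14.4) consumes (`θ^{β′}` per cube of `X″` reached only by walks).

statement-level skeleton of published theorems with citation tags; proofs where landed; nothing here is a claim about the Yang–Mills mass gap

PDF held: `paper:balaban1988-cmp114-bij-abelian-higgs-effective-action` (journal page = PDF page + 256); pages re-read this session as text: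
PDF 51 (p. 307) L13–18, PDF 59 (p. 315, reference [9]).

CITATION HEADER (lean-in-tree rule).  Part of the lit-balaban TYPED SKELETON (HOME `run/shared/lean/pub/lit-balaban/`), Phase 2, seat p36
(gen 21, unit `lit-balaban-p36`); rows **C2.Eq5.14.3-5.14.4** (member: §f estimate E3 — the kept decay of the trains = the `θ^{β′}` currency of
the far cubes in `h5144three`, and the walk/`Σ_P` counting constant `K` per boundary) and C2.Eq5.13.3-5.13.4 (member) of
`HOME/lit-balaban-r16/ROWS-C2-part2.md` (owner r16, referee ref-5).
WHAT IS REPRODUCED (theorem-only; no definitions, no `Prop` facts; axioms standard):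
* §1 **`supersolution_kept`** (split gauges + kept functional ⇒ `K^{|c|}·Q` is a supersolution), **`abs_C_mul_wker_apply_le_kept`** (the walk
  kernel on exit sets), `abs_C_mul_wker_apply_le_kept_entry` (from any site, entrance gauges split likewise).
* §2 **`kept_farthest`** (the farthest-boundary functional is a kept functional), **`abs_C_mul_wker_apply_le_farthest`**
  (`|(C𝔫(c))(x′,q)| ≤ a(aZmK)^{|c|}·G b b″` for every `b″ ∈ c`), `abs_C_mul_wker_apply_le_farthest_exit` (`… ≤ a(aZmK)^{|c|}·Q₀ b`: the kept exit
  decay instead).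
HONEST SCOPE.  Pure bookkeeping over the certificate interface of `BIJ88WalkKernelDecay307`; the pseudo-metric on boundaries, the lattice sums
`K`, and the conversion `e^{−κ r(e_k)} ≤ θ^{β′}` are the reader's (p. 307 gives no constants).  The optimal kept functional (tree length of
`c ∪ {b}`, as in [9]) is NOT typed here — only the farthest-point one, which is what one far cube needs.
-/

namespace Literature.MathematicalPhysics.QuantumFieldTheory.BalabanImbrieJaffe1984to88.BIJ88WalkKeptDecay307

open Finset Matrix
open scoped BigOperators
open BIJ88TrainPieces306 (wker)
open BIJ88WalkKernelDecay307 (abs_C_mul_wker_apply_le abs_C_mul_wker_apply_le_entry)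

variable {β : Type*} [DecidableEq β]

/-! ## §1  Split gauges and kept functionals give supersolutions -/

/-- **HALF SUMMED, HALF KEPT.**  If `E ≤ F·G` with `F ≥ 0` summable (`Σ_{b′∈c} F b b′ ≤ K`) and `Q ≥ 0` is a kept functional for `G`
(`G b b′ · Q b′ (c∖b′) ≤ Q b c` for `b′ ∈ c`), then `W b c = K^{|c|} Q b c` satisfies the walk recursion
`Σ_{b′∈c} E b b′ · W b′ (c∖b′) ≤ W b c` (`c ≠ ∅`) — the step *"as in [9]"*. [cite: BalabanImbrieJaffe1988, §5.13 p.307] -/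
theorem supersolution_kept {E F G : β → β → ℝ} {Q : β → Finset β → ℝ} {K : ℝ}
    (hEFG : ∀ b b', E b b' ≤ F b b' * G b b') (hF0 : ∀ b b', 0 ≤ F b b') (hK : ∀ (b : β) (c : Finset β), ∑ b' ∈ c, F b b' ≤ K)
    (hQ0 : ∀ b c, 0 ≤ Q b c) (hQ : ∀ (b : β) (c : Finset β), ∀ b' ∈ c, G b b' * Q b' (c.erase b') ≤ Q b c) (b : β) (c : Finset β)
    (hc : c.Nonempty) : ∑ b' ∈ c, E b b' * (K ^ (c.erase b').card * Q b' (c.erase b')) ≤ K ^ c.card * Q b c := by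
  obtain ⟨b₀, hb₀⟩ := id hc
  have hK0 : 0 ≤ K := by simpa using hK b₀ ∅
  obtain ⟨k, hk⟩ := Nat.exists_eq_add_one_of_ne_zero (card_ne_zero.2 hc)
  have h1 : ∀ b' ∈ c, E b b' * (K ^ (c.erase b').card * Q b' (c.erase b')) ≤ K ^ k * (F b b' * Q b c) := fun b' hb' => by
    rw [card_erase_of_mem hb', hk, Nat.add_sub_cancel]
    calc E b b' * (K ^ k * Q b' (c.erase b')) ≤ (F b b' * G b b') * (K ^ k * Q b' (c.erase b')) :=
          mul_le_mul_of_nonneg_right (hEFG b b') (mul_nonneg (pow_nonneg hK0 k) (hQ0 _ _))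
      _ = K ^ k * (F b b' * (G b b' * Q b' (c.erase b'))) := by ring
      _ ≤ K ^ k * (F b b' * Q b c) :=
          mul_le_mul_of_nonneg_left (mul_le_mul_of_nonneg_left (hQ b c b' hb') (hF0 b b')) (pow_nonneg hK0 k)
  refine (sum_le_sum h1).trans ?_
  rw [← mul_sum, ← sum_mul, hk, pow_succ]
  calc K ^ k * ((∑ b' ∈ c, F b b') * Q b c) ≤ K ^ k * (K * Q b c) :=
        mul_le_mul_of_nonneg_left (mul_le_mul_of_nonneg_right (hK b c) (hQ0 b c)) (pow_nonneg hK0 k)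
    _ = K ^ k * K * Q b c := by ring

variable {α : Type} [Fintype α] [DecidableEq α] {I : Type} [DecidableEq I]

/-- **THE WALK KERNEL WITH KEPT DECAY (exit sets).**  Letters of `BIJ88WalkKernelDecay307.abs_C_mul_wker_apply_le` (`|C(y,x)| ≤ a e^{−δρ}`,
lattice sums `Z`, boundary terms supported on `U_b × U′_b` with row sums `≤ m`, gauges `E`, `Eout`), the gauges split as `E ≤ F·G` with `F`
summable (`≤ K`) and a kept functional `Q ≥ 0` for `G` with `Eout b ≤ Q b ∅`: then on every exit set
`|(C𝔫(c))(x′,q)| ≤ a · (aZmK)^{|c|} · Q b c`. [cite: BalabanImbrieJaffe1988, §5.13 p.307] -/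
theorem abs_C_mul_wker_apply_le_kept {C : Matrix α α ℝ} {N : Finset I → Matrix α α ℝ} {ρ : α → α → ℝ} {a δ Z m K : ℝ}
    {U U' : Finset I → Set α} (hρ : ∀ y x, 0 ≤ ρ y x) (hδ : 0 ≤ δ) (hC : ∀ y x, |C y x| ≤ a * Real.exp (-(δ * ρ y x)))
    (hZ : ∀ y, ∑ x, Real.exp (-(δ / 2 * ρ y x)) ≤ Z) (hsupp : ∀ b x x', N b x x' ≠ 0 → x ∈ U b ∧ x' ∈ U' b)
    (hrow : ∀ b x, ∑ x', |N b x x'| ≤ m) (q : α) {E F G : Finset I → Finset I → ℝ} {Eout : Finset I → ℝ}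
    (hE0 : ∀ b b', 0 ≤ E b b') (hE : ∀ b b', ∀ x' ∈ U' b, ∀ x ∈ U b', Real.exp (-(δ / 2 * ρ x' x)) ≤ E b b')
    (hEout : ∀ b, ∀ x' ∈ U' b, Real.exp (-(δ / 2 * ρ x' q)) ≤ Eout b) (hEFG : ∀ b b', E b b' ≤ F b b' * G b b')
    (hF0 : ∀ b b', 0 ≤ F b b') (hK : ∀ (b : Finset I) (c : Finset (Finset I)), ∑ b' ∈ c, F b b' ≤ K)
    {Q : Finset I → Finset (Finset I) → ℝ} (hQ0 : ∀ b c, 0 ≤ Q b c) (hQe : ∀ b, Eout b ≤ Q b ∅)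
    (hQ : ∀ (b : Finset I) (c : Finset (Finset I)), ∀ b' ∈ c, G b b' * Q b' (c.erase b') ≤ Q b c) (c : Finset (Finset I))
    (b : Finset I) : ∀ x' ∈ U' b, |(C * wker C N c) x' q| ≤ a * (a * Z * m * K) ^ c.card * Q b c := by
  intro x' hx'
  have hK0 : 0 ≤ K := by simpa using hK b ∅
  have h := abs_C_mul_wker_apply_le hρ hδ hC hZ hsupp hrow q hE0 hE hEout (W := fun b c => K ^ c.card * Q b c)
    (fun _ _ => mul_nonneg (pow_nonneg hK0 _) (hQ0 _ _)) (fun b => by simpa using hQe b)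
    (fun b c hc => supersolution_kept hEFG hF0 hK hQ0 hQ b c hc) c b x' hx'
  exact h.trans (le_of_eq (by ring))

/-- **… from any site `p`** (`c ≠ ∅`), the entrance gauges split likewise, `Ein ≤ Fin·Gin` with `Σ_{b′∈c} Fin b′ ≤ K`, and the kept entrance
decay threaded into the kept functional (`Gin b′ · Q b′ (c∖b′) ≤ Qin` for `b′ ∈ c`): `|(C𝔫(c))(p,q)| ≤ a · (aZmK)^{|c|} · Qin`.
[cite: BalabanImbrieJaffe1988, §5.13 p.307] -/
theorem abs_C_mul_wker_apply_le_kept_entry {C : Matrix α α ℝ} {N : Finset I → Matrix α α ℝ} {ρ : α → α → ℝ} {a δ Z m K : ℝ}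
    {U U' : Finset I → Set α} (hρ : ∀ y x, 0 ≤ ρ y x) (hδ : 0 ≤ δ) (hC : ∀ y x, |C y x| ≤ a * Real.exp (-(δ * ρ y x)))
    (hZ : ∀ y, ∑ x, Real.exp (-(δ / 2 * ρ y x)) ≤ Z) (hsupp : ∀ b x x', N b x x' ≠ 0 → x ∈ U b ∧ x' ∈ U' b)
    (hrow : ∀ b x, ∑ x', |N b x x'| ≤ m) (q : α) {E F G : Finset I → Finset I → ℝ} {Eout : Finset I → ℝ}
    (hE0 : ∀ b b', 0 ≤ E b b') (hE : ∀ b b', ∀ x' ∈ U' b, ∀ x ∈ U b', Real.exp (-(δ / 2 * ρ x' x)) ≤ E b b')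
    (hEout : ∀ b, ∀ x' ∈ U' b, Real.exp (-(δ / 2 * ρ x' q)) ≤ Eout b) (hEFG : ∀ b b', E b b' ≤ F b b' * G b b')
    (hF0 : ∀ b b', 0 ≤ F b b') (hK : ∀ (b : Finset I) (c : Finset (Finset I)), ∑ b' ∈ c, F b b' ≤ K)
    {Q : Finset I → Finset (Finset I) → ℝ} (hQ0 : ∀ b c, 0 ≤ Q b c) (hQe : ∀ b, Eout b ≤ Q b ∅)
    (hQ : ∀ (b : Finset I) (c : Finset (Finset I)), ∀ b' ∈ c, G b b' * Q b' (c.erase b') ≤ Q b c)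
    (p : α) {Ein Fin Gin : Finset I → ℝ} (hEin0 : ∀ b', 0 ≤ Ein b') (hEin : ∀ b', ∀ x ∈ U b', Real.exp (-(δ / 2 * ρ p x)) ≤ Ein b')
    (hEin' : ∀ b', Ein b' ≤ Fin b' * Gin b') (hFin0 : ∀ b', 0 ≤ Fin b') {c : Finset (Finset I)} (hc : c.Nonempty)
    (hKin : ∑ b' ∈ c, Fin b' ≤ K) {Qin : ℝ} (hQin0 : 0 ≤ Qin) (hQin : ∀ b' ∈ c, Gin b' * Q b' (c.erase b') ≤ Qin) :
    |(C * wker C N c) p q| ≤ a * (a * Z * m * K) ^ c.card * Qin := by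
  obtain ⟨b₀, hb₀⟩ := id hc
  have hK0 : 0 ≤ K := by simpa using hK b₀ ∅
  have ha : 0 ≤ a := by
    by_contra h
    have h' : a * Real.exp (-(δ * ρ p q)) < 0 := mul_neg_of_neg_of_pos (lt_of_not_ge h) (Real.exp_pos _)
    linarith [abs_nonneg (C p q), hC p q]
  have hZ0 : 0 ≤ Z := (sum_nonneg fun _ _ => (Real.exp_pos _).le).trans (hZ p)
  have hm : 0 ≤ m := (sum_nonneg fun _ _ => abs_nonneg _).trans (hrow b₀ p)
  have h := abs_C_mul_wker_apply_le_entry hρ hδ hC hZ hsupp hrow q hE0 hE hEout (W := fun b c => K ^ c.card * Q b c)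
    (fun _ _ => mul_nonneg (pow_nonneg hK0 _) (hQ0 _ _)) (fun b => by simpa using hQe b)
    (fun b c hc => supersolution_kept hEFG hF0 hK hQ0 hQ b c hc) p hEin0 hEin hc
  obtain ⟨k, hk⟩ := Nat.exists_eq_add_one_of_ne_zero (card_ne_zero.2 hc)
  have h1 : ∀ b' ∈ c, Ein b' * (K ^ (c.erase b').card * Q b' (c.erase b')) ≤ K ^ k * Qin * Fin b' := fun b' hb' => by
    rw [card_erase_of_mem hb', hk, Nat.add_sub_cancel]
    calc Ein b' * (K ^ k * Q b' (c.erase b')) ≤ (Fin b' * Gin b') * (K ^ k * Q b' (c.erase b')) :=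
          mul_le_mul_of_nonneg_right (hEin' b') (mul_nonneg (pow_nonneg hK0 k) (hQ0 _ _))
      _ = K ^ k * (Gin b' * Q b' (c.erase b')) * Fin b' := by ring
      _ ≤ K ^ k * Qin * Fin b' :=
          mul_le_mul_of_nonneg_right (mul_le_mul_of_nonneg_left (hQin b' hb') (pow_nonneg hK0 k)) (hFin0 b')
  refine h.trans ?_
  rw [hk]
  calc a * (a * Z * m) ^ (k + 1) * ∑ b' ∈ c, Ein b' * (K ^ (c.erase b').card * Q b' (c.erase b'))
      ≤ a * (a * Z * m) ^ (k + 1) * (K ^ k * Qin * K) := by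
        refine mul_le_mul_of_nonneg_left ((sum_le_sum h1).trans ?_) (by positivity)
        rw [← mul_sum]
        exact mul_le_mul_of_nonneg_left hKin (mul_nonneg (pow_nonneg hK0 k) hQin0)
    _ = a * (a * Z * m * K) ^ (k + 1) * Qin := by ring

/-! ## §2  The farthest prescribed boundary is a kept functional -/

/-- **THE FARTHEST-BOUNDARY FUNCTIONAL.**  `G ≥ 0` super-multiplicative along triangles (`G b b′ · G b′ b″ ≤ G b b″` — `G = e^{−κd}` for a
pseudo-metric `d` on boundaries), an exit weight `Q₀ ≤ 1` with `G b b′ · Q₀ b′ ≤ Q₀ b`; then for each target boundary `b″` the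
functional `Q b c = (b″ ∈ c ? G b b″ : Q₀ b)` is kept: `G b b′ · Q b′ (c∖b′) ≤ Q b c` for `b′ ∈ c` (three cases: `b′ = b″`; `b′ ≠ b″ ∈ c` by the
triangle; `b″ ∉ c` by the exit compatibility). [cite: BalabanImbrieJaffe1988, §5.13 p.307] -/
theorem kept_farthest {G : β → β → ℝ} {Q₀ : β → ℝ} (hG0 : ∀ b b', 0 ≤ G b b') (hGt : ∀ b b' b'', G b b' * G b' b'' ≤ G b b'')
    (hQ₀1 : ∀ b, Q₀ b ≤ 1) (hQ₀t : ∀ b b', G b b' * Q₀ b' ≤ Q₀ b) (b'' : β) (b : β) (c : Finset β) :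
    ∀ b' ∈ c, G b b' * (if b'' ∈ c.erase b' then G b' b'' else Q₀ b') ≤ (if b'' ∈ c then G b b'' else Q₀ b) := by
  intro b' hb'
  by_cases h'' : b'' ∈ c
  · rw [if_pos h'']
    by_cases he : b' = b''
    · subst he
      rw [if_neg (notMem_erase b' c)]
      exact (mul_le_mul_of_nonneg_left (hQ₀1 b') (hG0 b b')).trans_eq (mul_one _)
    · rw [if_pos (mem_erase.2 ⟨Ne.symm he, h''⟩)]
      exact hGt b b' b''
  · rw [if_neg h'', if_neg fun h => h'' (mem_of_mem_erase h)]
    exact hQ₀t b b'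

/-- **EVERY WALK OUT OF `b` THROUGH `c ∋ b″` PAYS THE KEPT DECAY TO `b″`.**  With the letters of `abs_C_mul_wker_apply_le_kept`, `G`, `Q₀` as in
`kept_farthest` and `Eout ≤ Q₀`: for `b″ ∈ c` and every exit site `x′ ∈ U′_b`, `|(C𝔫(c))(x′,q)| ≤ a · (aZmK)^{|c|} · G b b″` — p. 307's
*"factors e^{−cr(e_k)}"* for a walk that must wander to a far cube, with the sum over its `|c|!` orders already paid (`K` per boundary).
[cite: BalabanImbrieJaffe1988, §5.13 p.307] -/
theorem abs_C_mul_wker_apply_le_farthest {C : Matrix α α ℝ} {N : Finset I → Matrix α α ℝ} {ρ : α → α → ℝ} {a δ Z m K : ℝ}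
    {U U' : Finset I → Set α} (hρ : ∀ y x, 0 ≤ ρ y x) (hδ : 0 ≤ δ) (hC : ∀ y x, |C y x| ≤ a * Real.exp (-(δ * ρ y x)))
    (hZ : ∀ y, ∑ x, Real.exp (-(δ / 2 * ρ y x)) ≤ Z) (hsupp : ∀ b x x', N b x x' ≠ 0 → x ∈ U b ∧ x' ∈ U' b)
    (hrow : ∀ b x, ∑ x', |N b x x'| ≤ m) (q : α) {E F G : Finset I → Finset I → ℝ} {Eout Q₀ : Finset I → ℝ}
    (hE0 : ∀ b b', 0 ≤ E b b') (hE : ∀ b b', ∀ x' ∈ U' b, ∀ x ∈ U b', Real.exp (-(δ / 2 * ρ x' x)) ≤ E b b')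
    (hEout : ∀ b, ∀ x' ∈ U' b, Real.exp (-(δ / 2 * ρ x' q)) ≤ Eout b) (hEFG : ∀ b b', E b b' ≤ F b b' * G b b')
    (hF0 : ∀ b b', 0 ≤ F b b') (hK : ∀ (b : Finset I) (c : Finset (Finset I)), ∑ b' ∈ c, F b b' ≤ K)
    (hG0 : ∀ b b', 0 ≤ G b b') (hGt : ∀ b b' b'', G b b' * G b' b'' ≤ G b b'')
    (hQ₀0 : ∀ b, 0 ≤ Q₀ b) (hQ₀1 : ∀ b, Q₀ b ≤ 1) (hQ₀t : ∀ b b', G b b' * Q₀ b' ≤ Q₀ b) (hEQ : ∀ b, Eout b ≤ Q₀ b)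
    {c : Finset (Finset I)} {b'' : Finset I} (hb'' : b'' ∈ c) (b : Finset I) :
    ∀ x' ∈ U' b, |(C * wker C N c) x' q| ≤ a * (a * Z * m * K) ^ c.card * G b b'' := by
  intro x' hx'
  have h := abs_C_mul_wker_apply_le_kept hρ hδ hC hZ hsupp hrow q hE0 hE hEout hEFG hF0 hK
    (Q := fun b c => if b'' ∈ c then G b b'' else Q₀ b) (fun b c => by split_ifs; exacts [hG0 _ _, hQ₀0 _])
    (fun b => by simpa using hEQ b) (fun b c b' hb' => kept_farthest hG0 hGt hQ₀1 hQ₀t b'' b c b' hb') c b x' hx'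
  simpa only [if_pos hb''] using h

/-- **… OR THE KEPT EXIT DECAY.**  Same letters; for every `c` (the target boundary need not be in `c`): `|(C𝔫(c))(x′,q)| ≤ a·(aZmK)^{|c|}·Q₀ b`
when `b″ ∉ c` — the last stretch to the endpoint `q` keeps its half of the decay. [cite: BalabanImbrieJaffe1988, §5.13 p.307] -/
theorem abs_C_mul_wker_apply_le_farthest_exit {C : Matrix α α ℝ} {N : Finset I → Matrix α α ℝ} {ρ : α → α → ℝ} {a δ Z m K : ℝ}
    {U U' : Finset I → Set α} (hρ : ∀ y x, 0 ≤ ρ y x) (hδ : 0 ≤ δ) (hC : ∀ y x, |C y x| ≤ a * Real.exp (-(δ * ρ y x)))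
    (hZ : ∀ y, ∑ x, Real.exp (-(δ / 2 * ρ y x)) ≤ Z) (hsupp : ∀ b x x', N b x x' ≠ 0 → x ∈ U b ∧ x' ∈ U' b)
    (hrow : ∀ b x, ∑ x', |N b x x'| ≤ m) (q : α) {E F G : Finset I → Finset I → ℝ} {Eout Q₀ : Finset I → ℝ}
    (hE0 : ∀ b b', 0 ≤ E b b') (hE : ∀ b b', ∀ x' ∈ U' b, ∀ x ∈ U b', Real.exp (-(δ / 2 * ρ x' x)) ≤ E b b')
    (hEout : ∀ b, ∀ x' ∈ U' b, Real.exp (-(δ / 2 * ρ x' q)) ≤ Eout b) (hEFG : ∀ b b', E b b' ≤ F b b' * G b b')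
    (hF0 : ∀ b b', 0 ≤ F b b') (hK : ∀ (b : Finset I) (c : Finset (Finset I)), ∑ b' ∈ c, F b b' ≤ K)
    (hG0 : ∀ b b', 0 ≤ G b b') (hGt : ∀ b b' b'', G b b' * G b' b'' ≤ G b b'')
    (hQ₀0 : ∀ b, 0 ≤ Q₀ b) (hQ₀1 : ∀ b, Q₀ b ≤ 1) (hQ₀t : ∀ b b', G b b' * Q₀ b' ≤ Q₀ b) (hEQ : ∀ b, Eout b ≤ Q₀ b)
    {c : Finset (Finset I)} {b'' : Finset I} (hb'' : b'' ∉ c) (b : Finset I) :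
    ∀ x' ∈ U' b, |(C * wker C N c) x' q| ≤ a * (a * Z * m * K) ^ c.card * Q₀ b := by
  intro x' hx'
  have h := abs_C_mul_wker_apply_le_kept hρ hδ hC hZ hsupp hrow q hE0 hE hEout hEFG hF0 hK
    (Q := fun b c => if b'' ∈ c then G b b'' else Q₀ b) (fun b c => by split_ifs; exacts [hG0 _ _, hQ₀0 _])
    (fun b => by simpa using hEQ b) (fun b c b' hb' => kept_farthest hG0 hGt hQ₀1 hQ₀t b'' b c b' hb') c b x' hx'
  simpa only [if_neg hb''] using h

end Literature.MathematicalPhysics.QuantumFieldTheory.BalabanImbrieJaffe1984to88.BIJ88WalkKeptDecay307
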